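import Summits.RiemannHypothesis.RiemannHypothesis.Theorems.HardyZLehmerSplitSigmaLLaguerreEnergyCone
import Summits.RiemannHypothesis.RiemannHypothesis.Theses.HardyZLehmerSplit
import HarnessLib

/-!
# Crux `SigmaL` (stmt-RiemannHypothesis-24253) — the EXACT LOCUS of the crux, by name: stub and crux
# from "critical points / wrong-sign candidates above the verified height avoid the exact cones"

Companion of `Theorems/HardyZLehmerSplitSigmaLLaguerreEnergyCone.lean` (pointwise EXACT-CONE theorem
`laguerreAtCritical_of_exactCone` and the unconditional locator
`exists_zero_exactCone_of_lehmer_violation`: a Lehmer violation of Hardy's `Z` at `t ≥ 3·10¹²` lies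
strictly inside the exact cone `|γ − t| < |β − ½|` of some zero `β + iγ` of `ζ`) and of
`Theorems/HardyZLehmerSplitSigmaLLaguerreConeReductions.lean` §7–§8 (the same reductions with the
DOUBLED cone `2|β − ½|`, and the Platt–Trudgian seam at `H₀ − 1`; not imported — this file builds only
on route-independent modules plus the route file itself). This module records the global reductions
with the exact aperture, so that the sharpest typed SUFFICIENT zero-side condition for the
leaf is a hypothesis of a tree theorem concluding the registered stub / the crux BY NAME:

* §13a `noViolationAt_of_exactCone` (pointwise, RH-free), `laguerreAtCritical_of_exactConesAvoidCritical`
  (the stub's statement verbatim), `SigmaL_of_exactConesAvoidExtrema` (the crux by name) — from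
  "at every critical point / local extremum `t > 3·10¹²` of `Z` with `Z(t) ≠ 0`, every zero `β + iγ`
  of `ζ` with `|γ − t| < 1` has `|β − ½| ≤ |γ − t|`" (on-line zeros satisfy this trivially); and the
  SHARP locators `exists_zero_exactCone_near_of_{laguerre,lehmer}_violation` (a violation at
  `t ≥ 3·10¹²` forces a zero with `0 < β < 1`, `β ≠ ½`, `|γ − t| < |β − ½|`, `|γ − t| < ½` — the tree's
  `exists_zero_exactCone_of_lehmer_violation` states only `|γ − t| < |β − ½|`, which distant trivial
  zeros also meet; `exactCone_of_noNearOffLineZero` supplies the strip/window bookkeeping);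
* §13b granted the cite fact `platt_trudgian_numerical_rh` (route conjunct `HeightPT`), the same with
  the hypothesis only at `t ≥ H₀ − 1 = 3 000 175 332 799` (seam `exactCone_of_platt_trudgian_of_above`:
  below `H₀` the cite fact puts the nearby zeros on the line, where the exact-cone condition is trivial;
  `laguerreAtCritical_of_platt_trudgian_of_exactConesAvoidCritical_above`,
  `SigmaL_of_platt_trudgian_of_exactConesAvoidExtrema_above`).

The hypothesis ("X" of the leaf's repair census) is RH-strength as a whole — each off-line zero's exact
cone covers its own ordinate — and it is SUFFICIENT, not equivalent (a thick in-cone zero need not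
spoil the sign); these are REDUCTIONS crediting nothing toward the stub. NOTHING HERE PROVES OR
ASSUMES RH; `SigmaL` and `stub_laguerreAtCritical` stay OPEN. References: Ivić 2003 §2 Prop. 1
[Ivic2003]; Platt–Trudgian 2021 Thm 1 [PlattTrudgian2021].
-/

set_option linter.dupNamespace false
set_option autoImplicit false

noncomputable section

open Filter Set
open scoped Topology
open Literature.NumberTheory.LFunctions
open Summit.RiemannHypothesis.RiemannHypothesis.Theses.HardyZLehmerSplit (SigmaL)

namespace Summit.RiemannHypothesis.RiemannHypothesis.Theorems.SigmaLBirth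

/-! ## §13a. The exact locus, RH-free -/

/-- **No Lehmer violation at `t` off the exact cones (pointwise, RH-free):** if `t ≥ 3·10¹²` and every
zero `β + iγ` of `ζ` with `|γ − t| < 1` satisfies `|β − ½| ≤ |γ − t|`, then a local minimum of `Z` at
`t` has `Z(t) ≤ 0` and a local maximum has `Z(t) ≥ 0` (second-derivative test `stub_secondDerivTest`
+ the exact-cone theorem `laguerreAtCritical_of_exactCone`; was `noViolationAt_of_offCone` with the
doubled cone). Unconditional; nothing here bears on the truth of RH.
[cite: Ivic2003, §2 Prop. 1 (exact-cone form)] -/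
theorem noViolationAt_of_exactCone {t : ℝ} (ht : 3000000000000 ≤ t)
    (hcone : ∀ s : ℂ, riemannZeta s = 0 → |s.im - t| < 1 → |s.re - 1 / 2| ≤ |s.im - t|) :
    (IsLocalMin hardyZ t → hardyZ t ≤ 0) ∧ (IsLocalMax hardyZ t → 0 ≤ hardyZ t) := by
  refine ⟨fun hmin ↦ ?_, fun hmax ↦ ?_⟩
  · by_contra hpos
    push Not at hpos
    obtain ⟨hd, hdd⟩ := (stub_secondDerivTest t).1 hmin
    have hlt := laguerreAtCritical_of_exactCone ht hcone hd hpos.ne'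
    have hge : 0 ≤ hardyZ t * deriv (deriv hardyZ) t := mul_nonneg hpos.le hdd
    linarith
  · by_contra hneg
    push Not at hneg
    obtain ⟨hd, hdd⟩ := (stub_secondDerivTest t).2 hmax
    have hlt := laguerreAtCritical_of_exactCone ht hcone hd hneg.ne
    have hge : 0 ≤ hardyZ t * deriv (deriv hardyZ) t := mul_nonneg_of_nonpos_of_nonpos hneg.le hdd
    linarith

/-- **Off the sharp locus ⇒ the exact-cone hypothesis.** If no zero `s = β + iγ` of `ζ` in the open
critical strip, off the line, has `|γ − t| < |β − ½|` together with `|γ − t| < ½`, then every zero with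
`|γ − t| < 1` satisfies `|β − ½| ≤ |γ − t|` (`t ≥ 1`): a zero with `|γ − t| < 1` is non-trivial (the
trivial zeros `−2(n+1)` have `γ = 0`, tree `riemannZeta_eq_zero_iff_of_re_nonpos`), so `0 < β < 1`
(Mathlib `riemannZeta_ne_zero_of_one_le_re`) and `|β − ½| < ½`. Bookkeeping that sharpens the locators
below (the bare conclusion `∃ s, ζ s = 0 ∧ |s.im − t| < |s.re − ½|` of
`exists_zero_exactCone_of_lehmer_violation` is also met by distant trivial zeros; the window `|γ − t| < ½`
and `0 < β < 1`, `β ≠ ½` are what the proof really gives). Unconditional; nothing here bears on the truth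
of RH. [folklore] -/
theorem exactCone_of_noNearOffLineZero {t : ℝ} (ht : 1 ≤ t)
    (h : ∀ s : ℂ, riemannZeta s = 0 → 0 < s.re → s.re < 1 → s.re ≠ 1 / 2 →
      |s.im - t| < |s.re - 1 / 2| → 1 / 2 ≤ |s.im - t|) :
    ∀ s : ℂ, riemannZeta s = 0 → |s.im - t| < 1 → |s.re - 1 / 2| ≤ |s.im - t| := by
  intro s hs h1
  by_contra hlt
  push Not at hlt
  have hre0 : 0 < s.re := by
    by_contra hle
    push Not at hle
    obtain ⟨n, hn⟩ := (riemannZeta_eq_zero_iff_of_re_nonpos hle).1 hs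
    have him : s.im = 0 := by rw [hn]; simp
    rw [him, zero_sub, abs_neg, abs_of_nonneg (by linarith : (0 : ℝ) ≤ t)] at h1
    linarith
  have hre1 : s.re < 1 := by
    by_contra hge
    push Not at hge
    exact riemannZeta_ne_zero_of_one_le_re hge hs
  have hne : s.re ≠ 1 / 2 := by
    intro e
    rw [e, sub_self, abs_zero] at hlt
    exact absurd hlt (not_lt.2 (abs_nonneg _))
  have hhalf := h s hs hre0 hre1 hne hlt
  have hlt' : |s.re - 1 / 2| < 1 / 2 := by
    rw [abs_lt]; constructor <;> linarith
  linarith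

/-- **SHARP EXACT-CONE LOCATOR for wrong curvature (RH-free, unconditional):** a wrong-curvature or
degenerate critical point of `Z` at `t ≥ 3·10¹²` (`Z'(t) = 0`, `Z(t) ≠ 0`, `Z(t)·Z''(t) ≥ 0`) forces a
zero `β + iγ` of `ζ` IN THE OPEN CRITICAL STRIP, OFF THE LINE (`0 < β < 1`, `β ≠ ½`), with
`|γ − t| < |β − ½|` and `|γ − t| < ½` (`laguerreAtCritical_of_exactCone` +
`exactCone_of_noNearOffLineZero`; sharpens `exists_zero_exactCone_of_laguerre_violation`). Nothing here
bears on the truth of RH. [cite: Ivic2003, §2 Prop. 1 (contrapositive, exact cone)] -/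
theorem exists_zero_exactCone_near_of_laguerre_violation {t : ℝ} (ht : 3000000000000 ≤ t)
    (hd : deriv hardyZ t = 0) (hZ : hardyZ t ≠ 0) (hL : 0 ≤ hardyZ t * deriv (deriv hardyZ) t) :
    ∃ s : ℂ, riemannZeta s = 0 ∧ 0 < s.re ∧ s.re < 1 ∧ s.re ≠ 1 / 2 ∧
      |s.im - t| < |s.re - 1 / 2| ∧ |s.im - t| < 1 / 2 := by
  by_contra h
  push Not at h
  have hcone := exactCone_of_noNearOffLineZero (by linarith) h
  exact absurd hL (not_le.2 (laguerreAtCritical_of_exactCone ht hcone hd hZ))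

/-- **SHARP EXACT-CONE LOCATOR for Lehmer violations (RH-free, unconditional):** a positive local
minimum or a negative local maximum of Hardy's `Z` at `t ≥ 3·10¹²` forces a zero `β + iγ` of `ζ` in
the open critical strip, OFF the line, with `|γ − t| < |β − ½|` and `|γ − t| < ½` — the violation sits
strictly inside the exact cone of an off-line zero at ordinate distance `< ½`
(`noViolationAt_of_exactCone` + `exactCone_of_noNearOffLineZero`; sharpens
`exists_zero_exactCone_of_lehmer_violation`). The crux `SigmaL` stays OPEN; nothing here bears on the
truth of RH. [cite: Ivic2003, §2 Prop. 1 (contrapositive, exact cone)] -/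
theorem exists_zero_exactCone_near_of_lehmer_violation {t : ℝ} (ht : 3000000000000 ≤ t)
    (hv : (IsLocalMin hardyZ t ∧ 0 < hardyZ t) ∨ (IsLocalMax hardyZ t ∧ hardyZ t < 0)) :
    ∃ s : ℂ, riemannZeta s = 0 ∧ 0 < s.re ∧ s.re < 1 ∧ s.re ≠ 1 / 2 ∧
      |s.im - t| < |s.re - 1 / 2| ∧ |s.im - t| < 1 / 2 := by
  by_contra h
  push Not at h
  have hno := noViolationAt_of_exactCone ht (exactCone_of_noNearOffLineZero (by linarith) h)
  rcases hv with ⟨hmin, hpos⟩ | ⟨hmax, hneg⟩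
  · exact absurd (hno.1 hmin) (not_le.2 hpos)
  · exact absurd (hno.2 hmax) (not_le.2 hneg)

/-- **The registered stub's statement from exact-cone avoidance at critical points (global, RH-free
reduction):** if at every critical point `t > 3·10¹²` of `Z` with `Z(t) ≠ 0` every zero `β + iγ` of `ζ`
with `|γ − t| < 1` has `|β − ½| ≤ |γ − t|`, then `∀ t > 3·10¹², Z'(t) = 0 → Z(t) ≠ 0 → Z(t)·Z''(t) < 0` —
literally the signature of `stub_laguerreAtCritical` (pointwise `laguerreAtCritical_of_exactCone`; was
`laguerreAtCritical_of_conesAvoidCritical` with the doubled cone). The hypothesis is RH-strength as a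
whole; a REDUCTION crediting nothing toward the stub; nothing here bears on the truth of RH.
[cite: Ivic2003, §2 Prop. 1 (exact-cone form)] -/
theorem laguerreAtCritical_of_exactConesAvoidCritical
    (h : ∀ t : ℝ, 3000000000000 < t → deriv hardyZ t = 0 → hardyZ t ≠ 0 →
      ∀ s : ℂ, riemannZeta s = 0 → |s.im - t| < 1 → |s.re - 1 / 2| ≤ |s.im - t|) :
    ∀ t : ℝ, 3000000000000 < t → deriv hardyZ t = 0 → hardyZ t ≠ 0 →
      hardyZ t * deriv (deriv hardyZ) t < 0 :=
  fun t ht hd hZ ↦ laguerreAtCritical_of_exactCone ht.le (h t ht hd hZ) hd hZ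

/-- **The crux `SigmaL` by name from exact-cone avoidance at the wrong-sign candidates (global, RH-free
reduction):** if at every local extremum `t > 3·10¹²` of `Z` with `Z(t) ≠ 0` every zero `β + iγ` of
`ζ` with `|γ − t| < 1` has `|β − ½| ≤ |γ − t|`, then `SigmaL` (pointwise `noViolationAt_of_exactCone`;
was `SigmaL_of_conesAvoidExtrema` with the doubled cone). RH-strength hypothesis; a REDUCTION
crediting nothing toward the crux; nothing here bears on the truth of RH.
[cite: Ivic2003, §2 Prop. 1 (exact-cone form)] -/
theorem SigmaL_of_exactConesAvoidExtrema
    (h : ∀ t : ℝ, 3000000000000 < t → (IsLocalMin hardyZ t ∨ IsLocalMax hardyZ t) →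
      hardyZ t ≠ 0 → ∀ s : ℂ, riemannZeta s = 0 → |s.im - t| < 1 → |s.re - 1 / 2| ≤ |s.im - t|) :
    SigmaL := by
  intro t ht
  refine ⟨fun hmin ↦ ?_, fun hmax ↦ ?_⟩
  · by_contra hpos
    push Not at hpos
    exact absurd ((noViolationAt_of_exactCone ht.le (h t ht (Or.inl hmin) hpos.ne')).1 hmin)
      (not_le.2 hpos)
  · by_contra hneg
    push Not at hneg
    exact absurd ((noViolationAt_of_exactCone ht.le (h t ht (Or.inr hmax) hneg.ne)).2 hmax)
      (not_le.2 hneg)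

/-! ## §13b. The exact locus above the Platt–Trudgian height -/

/-- **The seam in exact-cone form:** granted the cite fact `platt_trudgian_numerical_rh` (every zero with
`0 < γ ≤ H₀ = 3 000 175 332 800` is on the line; route conjunct `HeightPT`, NOT proved in the tree), the
exact-cone hypothesis at a point `t > 3·10¹²` follows from the exact-cone hypothesis demanded only when
`t ≥ H₀ − 1`: a zero with `|γ − t| < 1` has `γ > t − 1 > 0`, and either `γ ≤ H₀` (then it is on the
line, `|β − ½| = 0`) or `γ > H₀`, which forces `t > H₀ − 1`. CONDITIONAL on the cite fact; nothing
here bears on the truth of RH. [cite: PlattTrudgian2021, Theorem 1] -/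
theorem exactCone_of_platt_trudgian_of_above (hPT : platt_trudgian_numerical_rh) {t : ℝ}
    (ht : 3000000000000 < t)
    (habove : 3000175332799 ≤ t →
      ∀ s : ℂ, riemannZeta s = 0 → |s.im - t| < 1 → |s.re - 1 / 2| ≤ |s.im - t|) :
    ∀ s : ℂ, riemannZeta s = 0 → |s.im - t| < 1 → |s.re - 1 / 2| ≤ |s.im - t| := by
  intro s hs h1
  have h1' := abs_lt.1 h1
  by_cases hsH : s.im ≤ 3000175332800
  · have hre : s.re = 1 / 2 := hPT s hs (by linarith [h1'.1]) hsH
    rw [hre, sub_self, abs_zero]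
    exact abs_nonneg _
  · push Not at hsH
    exact habove (by linarith [h1'.2]) s hs h1

/-- **The stub, granted `platt_trudgian_numerical_rh`, from exact-cone avoidance at critical points
`t ≥ H₀ − 1` only:** if at every critical point `t ≥ 3 000 175 332 799` of `Z` with `Z(t) ≠ 0` every
zero `β + iγ` of `ζ` with `|γ − t| < 1` has `|β − ½| ≤ |γ − t|`, then the registered stub's statement
holds verbatim (`exactCone_of_platt_trudgian_of_above` + `laguerreAtCritical_of_exactCone`; was
`laguerreAtCritical_of_platt_trudgian_of_above'` composed with the doubled cone). CONDITIONAL on the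
cite fact; the `t ≥ H₀ − 1` hypothesis is RH-strength; a REDUCTION crediting nothing; nothing here
bears on the truth of RH. [cite: PlattTrudgian2021, Theorem 1] -/
theorem laguerreAtCritical_of_platt_trudgian_of_exactConesAvoidCritical_above
    (hPT : platt_trudgian_numerical_rh)
    (habove : ∀ t : ℝ, 3000175332799 ≤ t → deriv hardyZ t = 0 → hardyZ t ≠ 0 →
      ∀ s : ℂ, riemannZeta s = 0 → |s.im - t| < 1 → |s.re - 1 / 2| ≤ |s.im - t|) :
    ∀ t : ℝ, 3000000000000 < t → deriv hardyZ t = 0 → hardyZ t ≠ 0 →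
      hardyZ t * deriv (deriv hardyZ) t < 0 :=
  fun t ht hd hZ ↦ laguerreAtCritical_of_exactCone ht.le
    (exactCone_of_platt_trudgian_of_above hPT ht fun hH ↦ habove t hH hd hZ) hd hZ

/-- **The crux `SigmaL` by name, granted `platt_trudgian_numerical_rh`, from exact-cone avoidance at the
wrong-sign candidates `t ≥ H₀ − 1` only** — the sharpest typed SUFFICIENT zero-side residual of the
leaf: "for every `t ≥ 3 000 175 332 799` at which `Z` has a local extremum with `Z(t) ≠ 0`, every zero
`β + iγ` of `ζ` with `|γ − t| < 1` has `|β − ½| ≤ |γ − t|`" (`exactCone_of_platt_trudgian_of_above` +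
`noViolationAt_of_exactCone`; was `SigmaL_of_platt_trudgian_of_conesAvoidExtrema_above`, doubled
cone). CONDITIONAL on the cite fact; RH-strength hypothesis; a REDUCTION crediting nothing; nothing
here bears on the truth of RH. [cite: PlattTrudgian2021, Theorem 1] -/
theorem SigmaL_of_platt_trudgian_of_exactConesAvoidExtrema_above
    (hPT : platt_trudgian_numerical_rh)
    (habove : ∀ t : ℝ, 3000175332799 ≤ t → (IsLocalMin hardyZ t ∨ IsLocalMax hardyZ t) →
      hardyZ t ≠ 0 → ∀ s : ℂ, riemannZeta s = 0 → |s.im - t| < 1 → |s.re - 1 / 2| ≤ |s.im - t|) :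
    SigmaL := by
  intro t ht
  refine ⟨fun hmin ↦ ?_, fun hmax ↦ ?_⟩
  · by_contra hpos
    push Not at hpos
    have hcone := exactCone_of_platt_trudgian_of_above hPT ht
      fun hH ↦ habove t hH (Or.inl hmin) hpos.ne'
    exact absurd ((noViolationAt_of_exactCone ht.le hcone).1 hmin) (not_le.2 hpos)
  · by_contra hneg
    push Not at hneg
    have hcone := exactCone_of_platt_trudgian_of_above hPT ht
      fun hH ↦ habove t hH (Or.inr hmax) hneg.ne
    exact absurd ((noViolationAt_of_exactCone ht.le hcone).2 hmax) (not_le.2 hneg)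

end Summit.RiemannHypothesis.RiemannHypothesis.Theorems.SigmaLBirth

end
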